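import Literature.MathematicalPhysics.QuantumFieldTheory.Balaban1983to89.TkOpsMarginal

/-!
# `Balaban1983to89.B15IntegrationForms` — T. Bałaban, *Large field renormalization. I. The basic step of the 𝐑 operation*,
Commun. Math. Phys. **122** (1989) 175–202 [Balaban1989LargeFieldI]: the integral EXPRESSIONS of Sect. 1 — the product
representation (1.2), the (n+1)-st integral (1.25), the fluctuation integral (1.60), the expression after the N
integrations (1.71) with the operations (1.72), and the Λ-integrated expression (1.76) — typed as explicit WORDS in the
operator model of `…Balaban1983to89.TkOpsMarginal`, with the printed bookkeeping sentences proved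

statement-level skeleton of published theorems with citation tags; proofs where landed; nothing here is a claim about
the Yang–Mills mass gap

PDF held: `paper:balaban1989-cmp122-large-field-i` (journal page = PDF page + 174).  Every quotation below was READ AS AN
IMAGE on the x2 renders `run/shared/lean/pub/pub-balaban/b2b-balaban-ref1/pages/1989-cmp122-large-field-I/…-p004, p008,
p014, p015, p018, p020-x2.png`.  [III] = [Balaban1988Convergent] ((2.19)–(2.22) p. 258: the operations `𝐓_k(X)`, their
one-step factors `𝐓^{(j)}(Z_{j+1} ∩ X)` and the form (2.21) of an unchanged one-step operation).

CITATION HEADER / WHAT IS REPRODUCED (mega-formalization `lit-balaban`, reader/typer r12 gen 2; HOME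
`run/shared/lean/pub/lit-balaban/`, rows `lit-balaban-r12/ROWS-B15.md` v4): SKELETON rows B15.Eq1.2, B15.Eq1.25, B15.Eq1.60,
B15.Eq1.71–1.72, B15.Eq1.76 — `absent · integral expression` at SKELETON v3.9.  THE MODEL is the one the tree already
uses for (2.19)–(2.22) [III] and quotes (1.1)/(1.2) of this paper in (`…TkOpsMarginal`, accepted): ALL field variables of
all scales are the coordinates `V : Π d, π d` of one `δ`-indexed product of measure spaces with reference measures `μ d`;
the densities / functionals acted upon are the bundled measurable `ℝ≥0∞`-valued functions `TkOpsMarginal.MDens π`; the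
operations are elements of the composition monoid `Function.End (MDens π)`; *"∫dV_j⌈_Y (weight) · (·)"* is the fibre
integral `TkOpsMarginal.intOp μ s w` over the variable set `s` against the weight `w` (Mathlib `lmarginal`); multiplication
by a characteristic function or a density is `mulOp`.  Each printed expression is then ONE definite word in this monoid
applied to ONE definite density, and is typed as such (`Eq12`, `form125`, `Data160.form`, `form171`/`Tpp`, `form176`), its
printed constituents being the ARGUMENTS.

READING (declared, not printed).  (a) The constraint *"δ(V̄_j V_{j+1}⁻¹)"* of (1.25)/(1.72) and of (2.21) [III] is an
explicit WEIGHT argument `dlt` (a measurable `ℝ≥0∞`-valued function of all variables), exactly as in `TkOpsMarginal`'s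
template of (2.21) (`LocalSystem.wt`); w.r.t. the product reference measure a δ-function is not a density, and the tree's
measure-theoretic reading of one renormalization transformation is the push-forward identity `Setup.IsRT` (DIVERGENCE F7
of the cell) — the words below do not depend on which weight is supplied.  (b) The variable sets *"A_j⌈_{Z_{j+1}∩Ω_{j+1}}"*,
*"V_j⌈_{Ω^c_{j+1}∖Z″_{j+1}}"*, *"B_j⌈_{…}"*, *"V_h⌈_{Z_h}"* are explicit `Finset δ` arguments, or come from explicit maps
`vV j Y` = the variables `V_j(b)`, `b` in the region `Y` (regions `Set ι` over one ambient point type `ι`, as in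
`Step.TkOps`); *"dV″⌈_{𝔹″_k ∩ Y}"* of (1.76) (*"V″ = V_j on Γ″_j, j = 0, 1, …, k"*) is `varsGen vV Γ″ k Y = ⋃_{j ≤ k}
vV j (Γ″_j ∩ Y)`.  (c) Real exponents (actions, quadratic forms, `ℙ^{(j)}`, `E₀^{(j)}`) are bundled measurable real
functions `MReal π`, entering through `expD A = exp ∘ A` (as `ℝ≥0∞`); in (1.60) the functional `𝔼_k + ℝ_k + 𝔹_k + 𝔹_k^{(n)}`
and the Wilson-action difference `A(1/(g_k^{(n)}(·))² − 1/g_j², ·)` are functions on an abstract measurable configuration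
type `Cfg`, composed with the two printed configurations (`Data160`).  (d) `𝕋_h(Z_h)` and the one-step operations not
displayed are `Function.End (MDens π)` arguments; for (1.2) over a `TkOpsMarginal.LocalSystem` they are its generated
operations and (1.2) is PROVED from (2.22) (`LocalSystem.prod222`) and the factor bookkeeping (`eq12_of_localSystem`).
NOT typed here: the passage (1.71) + (1.75) ⟹ (1.76) (*"They are all integrated out"*, p. 194: the δ-constraints of the
last N steps integrate, over Λ, to the free variables on the generating set `𝔹″_k` — an identity of the averaging
operations, [12]); the bounds and the analyticity statements around (1.60); the 𝐑-operation itself ((0.3), `…B15.Rop`).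
Every declaration is a definition, a definitional unfolding, or a theorem proved from Mathlib's `lmarginal` calculus
(`B15.BasicStep.lmarginal_mul_of_indepOf`) and list bookkeeping; nothing printed is asserted as a fact.
v1.1 (append-only, `lit-balaban-r12` gen 5): Part F — *"the ∫ in (1.60)"* as its own word (`Data160.integral`,
`form = prefactor · integral` by `rfl`) and the FIRST member of (1.62), `ℂ_k^{(n+1)} = log(the ∫ in (1.60)) + A(…, U_k^{(n+1)})`
(`Data160.C162`; `expD_C162`: `e^{ℂ} = (∫) · e^{A(…)}` where the integral is positive and finite).
-/

open scoped BigOperators ENNReal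
open _root_.MeasureTheory Function Finset

namespace Literature.MathematicalPhysics.QuantumFieldTheory.Balaban1983to89.B15IntegrationForms

noncomputable section

open Literature.MathematicalPhysics.QuantumFieldTheory.Balaban1983to89.Step
open Literature.MathematicalPhysics.QuantumFieldTheory.Balaban1983to89.B15.BasicStep
open Literature.MathematicalPhysics.QuantumFieldTheory.Balaban1983to89.TkOpsMarginal

/-! ## Part A. Weights, multiplication operators, exponentials; the two bookkeeping identities of fibre integrals -/

section Operators

variable {δ : Type*} {π : δ → Type*} [∀ d, MeasurableSpace (π d)]

/-- The product of two (bundled measurable) weights / densities, e.g. *"χ(Z_{j+1}∩Ω_{j+1}) exp[−½⟨A_j, C*ΔCA_j⟩]"* in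
(1.25). [cite: Balaban1989LargeFieldI, (1.25) p.182] -/
def wmul (v w : MDens π) : MDens π := ⟨v.1 * w.1, v.2.mul w.2⟩

/-- Pointwise formula of `wmul` (definitional). [cite: Balaban1989LargeFieldI, (1.25) p.182] -/
@[simp] theorem wmul_val (v w : MDens π) : (wmul v w).1 = v.1 * w.1 := rfl

/-- A constant weight (the normalization factor *"z^{(j)}"* of (1.60)). [cite: Balaban1989LargeFieldI, (1.60) p.188] -/
def wconst (c : ℝ≥0∞) : MDens π := ⟨fun _ => c, measurable_const⟩

/-- The weight `1` (an integral *"∫dV″⌈_{…}"* with no displayed weight, (1.76)). [cite: Balaban1989LargeFieldI, (1.76) p.194] -/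
def wone : MDens π := wconst 1

/-- Bundled measurable REAL functions of all the variables: actions `A_k^{(n)}`, quadratic forms `⟨A_j, C*Δ^{(j)}CA_j⟩`,
`ℙ^{(j)}(g_j, A_j, B_j)` (READING (c)). [cite: Balaban1989LargeFieldI, (1.60) p.188] -/
abbrev MReal (π : δ → Type*) [∀ d, MeasurableSpace (π d)] := {f : (∀ d, π d) → ℝ // Measurable f}

/-- Sum of two real functionals (*"A″_k = A_k + 𝔹″_k"*, (1.72)). [cite: Balaban1989LargeFieldI, (1.72) p.192] -/
def radd (A B : MReal π) : MReal π := ⟨A.1 + B.1, A.2.add B.2⟩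

/-- `exp A` of a real functional as an `ℝ≥0∞`-valued density (*"exp A_k"* in (1.2), *"exp A_k^{(n)}"* in (1.25)).
[cite: Balaban1989LargeFieldI, (1.2) p.178] -/
def expD (A : MReal π) : MDens π :=
  ⟨fun V => ENNReal.ofReal (Real.exp (A.1 V)), ENNReal.measurable_ofReal.comp (Real.measurable_exp.comp A.2)⟩

/-- Pointwise formula of `expD` (definitional). [cite: Balaban1989LargeFieldI, (1.2) p.178] -/
@[simp] theorem expD_val (A : MReal π) (V : ∀ d, π d) : (expD A).1 V = ENNReal.ofReal (Real.exp (A.1 V)) := rfl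

/-- `exp(A + B) = exp A · exp B` for the bundled densities (used with (1.72): `exp A″_k = exp A_k · exp 𝔹″_k`). [cite: Balaban1989LargeFieldI, (1.72) p.192] -/
theorem expD_radd (A B : MReal π) : expD (radd A B) = wmul (expD A) (expD B) := by
  apply Subtype.ext
  funext V
  show ENNReal.ofReal (Real.exp (A.1 V + B.1 V)) = ENNReal.ofReal (Real.exp (A.1 V)) * ENNReal.ofReal (Real.exp (B.1 V))
  rw [Real.exp_add, ENNReal.ofReal_mul (Real.exp_pos _).le]

/-- MULTIPLICATION by a weight (a characteristic function `χ_k(Ω_k^{∼4})`, `χ_h(…)`, a density) as an element of the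
operation monoid `Function.End (MDens π)` — the explicitly written characteristic functions of (1.2), (1.71), (1.76).
[cite: Balaban1989LargeFieldI, (1.2) p.178] -/
def mulOp (w : MDens π) : Function.End (MDens π) := fun F => wmul w F

/-- Pointwise formula of `mulOp` (definitional). [cite: Balaban1989LargeFieldI, (1.2) p.178] -/
@[simp] theorem mulOp_apply_val (w F : MDens π) : ((mulOp w) F).1 = w.1 * F.1 := rfl

/-- Multiplication operators compose to the multiplication by the product (the two prefactors `χ_k(Ω_k^{∼4}) χ_{k,Λ}` of
(1.76)). [cite: Balaban1989LargeFieldI, (1.76) p.194] -/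
theorem mulOp_mul (v w : MDens π) : mulOp v * mulOp w = mulOp (wmul v w) := by
  funext F
  apply Subtype.ext
  show v.1 * (w.1 * F.1) = v.1 * w.1 * F.1
  rw [mul_assoc]

variable [DecidableEq δ] (μ : ∀ d, Measure (π d)) [∀ d, SigmaFinite (μ d)]

/-- A multiplication operator is the fibre integral over NO variables (`lmarginal_empty`): `mulOp w = intOp μ ∅ w` — so the
explicitly written characteristic functions of (1.2) are operations of the same monoid as the `𝕋^{(j)}`. [cite: Balaban1989LargeFieldI, (1.2) p.178] -/
theorem mulOp_eq_intOp_empty (w : MDens π) : mulOp w = intOp μ ∅ w.1 w.2 := by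
  funext F
  apply Subtype.ext
  show w.1 * F.1 = ∫⋯∫⁻_∅, w.1 * F.1 ∂μ
  rw [lmarginal_empty]

/-- **PULL-OUT** — the bookkeeping behind the first characteristic function of (1.2) (p. 178: *"we have written explicitly
the first and the last characteristic functions in the product of the last N one-step operations"*) and the sentence of
p. 182 after (1.25) (*"The function χ_k^{(n+1)} does not depend on integration variables, and we have to consider the
integral (1.25) multiplied by χ_k^{(n+1)}"*): a factor that does not depend on the integrated variables `s` commutes with
the fibre integral, `∫_s w·(χ·F) = χ·∫_s w·F`.  PROVED (`B15.BasicStep.lmarginal_mul_of_indepOf`). [cite: Balaban1989LargeFieldI, p.182 (after (1.25))] -/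
theorem intOp_mulOp_of_indepOf (s : Finset δ) (v χ : MDens π) (hχ : IndepOf s χ.1) :
    intOp μ s v.1 v.2 * mulOp χ = mulOp χ * intOp μ s v.1 v.2 := by
  funext F
  apply Subtype.ext
  show ∫⋯∫⁻_s, v.1 * (χ.1 * F.1) ∂μ = χ.1 * ∫⋯∫⁻_s, v.1 * F.1 ∂μ
  rw [mul_left_comm]
  exact lmarginal_mul_of_indepOf s hχ (v.2.mul F.2)

/-- The same, with the factor put INTO the weight: `χ · ∫_s w·F = ∫_s (χw)·F` for `χ` independent of `s` (the first
characteristic function of (1.2) read back into the top one-step operation). [cite: Balaban1989LargeFieldI, (1.2) p.178] -/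
theorem mulOp_intOp_of_indepOf (s : Finset δ) (v χ : MDens π) (hχ : IndepOf s χ.1) :
    mulOp χ * intOp μ s v.1 v.2 = intOp μ s (wmul χ v).1 (wmul χ v).2 := by
  funext F
  apply Subtype.ext
  show χ.1 * ∫⋯∫⁻_s, v.1 * F.1 ∂μ = ∫⋯∫⁻_s, χ.1 * v.1 * F.1 ∂μ
  rw [mul_assoc, lmarginal_mul_of_indepOf s hχ (v.2.mul F.2)]

/-- **ABSORPTION** — the bookkeeping behind the last characteristic function of (1.2): a factor of the weight of a fibre
integral may be written as acting on the integrand first, `∫_s (wχ)·F = ∫_s w·(χ·F)` (definitional regrouping). [cite: Balaban1989LargeFieldI, (1.2) p.178] -/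
theorem intOp_wmul (s : Finset δ) (v χ : MDens π) :
    intOp μ s (wmul v χ).1 (wmul v χ).2 = intOp μ s v.1 v.2 * mulOp χ := by
  funext F
  apply Subtype.ext
  show ∫⋯∫⁻_s, v.1 * χ.1 * F.1 ∂μ = ∫⋯∫⁻_s, v.1 * (χ.1 * F.1) ∂μ
  rw [mul_assoc]

end Operators

/-! ## Part B. The ordered products and (1.2) p. 178 -/

section OrderedProducts

variable {M : Type*} [Monoid M]

/-- The ORDERED product `Π_{j=k−1}^{h} O_j = O_{k−1} · O_{k−2} ⋯ O_h` (leftmost factor `j = k − 1`, as printed in (1.2) and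
(1.71); `Step.TkOps.tail` / `TkOpsMarginal.LocalSystem.prod222` write the same list product inline). [cite: Balaban1989LargeFieldI, (1.2) p.178] -/
def ordProd (O : ℕ → M) (h k : ℕ) : M := (((List.Ico h k).reverse).map O).prod

/-- `ordProd` unfolded (definitional). [cite: Balaban1989LargeFieldI, (1.2) p.178] -/
theorem ordProd_eq (O : ℕ → M) (h k : ℕ) : ordProd O h k = (((List.Ico h k).reverse).map O).prod := rfl

/-- One factor (`N = 1` in (1.2)): `Π_{j=h}^{h} O_j = O_h`. [cite: Balaban1989LargeFieldI, (1.2) p.178] -/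
theorem ordProd_one (O : ℕ → M) (h : ℕ) : ordProd O h (h + 1) = O h := by
  simp [ordProd, List.Ico.succ_singleton]

/-- Splitting off the top factor of the ordered product of (1.2): `Π_{j=m}^{h} O_j = O_m · Π_{j=m−1}^{h} O_j`. [cite: Balaban1989LargeFieldI, (1.2) p.178] -/
theorem ordProd_succ_top (O : ℕ → M) {h m : ℕ} (hhm : h ≤ m) : ordProd O h (m + 1) = O m * ordProd O h m := by
  simp [ordProd, List.Ico.succ_top hhm, List.reverse_append]

/-- Splitting off the bottom factor of the ordered product of (1.2): `Π_{j=k−1}^{h} O_j = (Π_{j=k−1}^{h+1} O_j) · O_h`. [cite: Balaban1989LargeFieldI, (1.2) p.178] -/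
theorem ordProd_eq_mul_bot (O : ℕ → M) {h k : ℕ} (hhk : h < k) : ordProd O h k = ordProd O (h + 1) k * O h := by
  simp [ordProd, List.Ico.eq_cons hhk, List.reverse_cons, List.map_append, List.prod_append]

/-- The ordered product of (1.2) depends only on the factors with indices in `[h, k)`. [cite: Balaban1989LargeFieldI, (1.2) p.178] -/
theorem ordProd_congr (O O' : ℕ → M) {h k : ℕ} (hO : ∀ j, h ≤ j → j < k → O j = O' j) :
    ordProd O h k = ordProd O' h k := by
  unfold ordProd
  congr 1
  apply List.map_congr_left
  intro j hj
  rw [List.mem_reverse, List.Ico.mem] at hj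
  exact hO j hj.1 hj.2

/-- **THE BOOKKEEPING OF (1.2)** in any monoid: if the top factor is `c · O′_{k−1}`, the bottom factor is `O′_h · d` (when
there is only one factor, `k − 1 = h`, it is `c · O′_h · d`) and the middle factors are unchanged, then
`Π_{j=k−1}^{h} O_j = c · (Π_{j=k−1}^{h} O′_j) · d` — writing *"explicitly the first and the last characteristic functions in
the product of the last N one-step operations"* (p. 178).  PROVED. [cite: Balaban1989LargeFieldI, (1.2) p.178] -/
theorem ordProd_factor (O O' : ℕ → M) (c d : M) {h k : ℕ} (hhk : h < k)
    (hmid : ∀ j, h < j → j + 1 < k → O j = O' j)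
    (htop : h + 1 < k → O (k - 1) = c * O' (k - 1))
    (hbot : h + 1 < k → O h = O' h * d)
    (hone : h + 1 = k → O h = c * O' h * d) :
    ordProd O h k = c * ordProd O' h k * d := by
  rcases Nat.lt_or_ge (h + 1) k with hlt | hge
  · obtain ⟨m, rfl⟩ : ∃ m, k = m + 1 := ⟨k - 1, by omega⟩
    have hhm : h < m := by omega
    have ht : O m = c * O' m := by simpa using htop hlt
    have hb : O h = O' h * d := hbot hlt
    have hmid' : ∀ j, h + 1 ≤ j → j < m → O j = O' j := fun j hj hjm => hmid j (by omega) (by omega)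
    rw [ordProd_succ_top O hhm.le, ordProd_succ_top O' hhm.le, ordProd_eq_mul_bot O hhm, ordProd_eq_mul_bot O' hhm,
      ordProd_congr O O' hmid', ht, hb]
    simp only [mul_assoc]
  · have hk : h + 1 = k := by omega
    subst hk
    rw [ordProd_one, ordProd_one, hone rfl]

end OrderedProducts

section Eq12

variable {δ : Type*} [DecidableEq δ] {π : δ → Type*} [∀ d, MeasurableSpace (π d)]

/-- **(1.2)** p. 178 [PDF 4], verbatim: *"We consider 𝕋_k(Z) exp A_k, and we use the above described simplified notation.
Using the conditions (i), (ii), and the factorization property (2.22) [III], we write 𝕋_k(Z) exp A_k = χ_k(Ω_k^{∼4})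
Π_{j=k−1}^{h} 𝕋^{(j)}(Z_{j+1}) χ_h(Ω∖Ω^∼_{h+1}) 𝕋_h(Z_h) exp A_k, (1.2) where h = k − N, and we have written explicitly the
first and the last characteristic functions in the product of the last N one-step operations. These operations are given
by the formula (2.21) [III], in which the functions ζ, χ have the simplest form, namely by the condition (ii) no large
field characteristic functions are included in them."* — the identity of densities, as a `Prop` in the operator model:
`Tk` = `𝕋_k(Z)`, `χk` = `χ_k(Ω_k^{∼4})`, `T1 j` = `𝕋^{(j)}(Z_{j+1})` (the explicitly written functions removed), `χh` =
`χ_h(Ω∖Ω^∼_{h+1})`, `Th` = `𝕋_h(Z_h)`, `expA` = `exp A_k` (READING (d)). [cite: Balaban1989LargeFieldI, (1.2) p.178] -/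
def Eq12 (Tk : Function.End (MDens π)) (χk : MDens π) (T1 : ℕ → Function.End (MDens π)) (χh : MDens π)
    (Th : Function.End (MDens π)) (expA : MDens π) (h k : ℕ) : Prop :=
  Tk expA = (mulOp χk * ordProd T1 h k * mulOp χh * Th : Function.End (MDens π)) expA

variable {ι : Type*} (S : LocalSystem ι δ π) (μ : ∀ d, Measure (π d)) [∀ d, SigmaFinite (μ d)]

/-- **(1.2) PROVED in the operator model.**  For the operations `𝕋_k(X)` GENERATED by (2.20) from a region-local system of
fibre integrals (`TkOpsMarginal.LocalSystem`, the tree's inhabited model of (2.19)–(2.22) [III]), a region `Z ⊆ Z_k`, the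
nesting `Z_{j+1} ⊆ Z_h (j < h)` (what (2.22) uses), and printed operations `T1′ j` that are the system's one-step operations
`𝕋^{(j)}(Z_{j+1} ∩ Z)` except that the top one has the factor `χ_k` pulled out in front (legitimate when `χ_k` does not
depend on its integration variables: `mulOp_intOp_of_indepOf`) and the bottom one has the factor `χ_h` written as acting
first (`intOp_wmul`), the identity (1.2) holds for every density `exp A_k`, with `𝕋_h(Z_h)` = the generated tail operation
`Π_{j=h−1}^{0} 𝕋^{(j)}(Z_{j+1} ∩ Z_h ∩ Z)`: (2.22) (`LocalSystem.prod222`) + `ordProd_factor`. [cite: Balaban1989LargeFieldI, (1.2) p.178] -/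
theorem eq12_of_localSystem {h k : ℕ} (hhk : h < k) (hZ : ∀ j, j < h → S.Z (j + 1) ⊆ S.Z h) (Z : Set ι)
    (hX : Z ⊆ S.Z k) (χk χh : MDens π) (T1' : ℕ → Function.End (MDens π))
    (hmid : ∀ j, h < j → j + 1 < k → S.T1 μ k j (S.Z (j + 1) ∩ Z) = T1' j)
    (htop : h + 1 < k → S.T1 μ k (k - 1) (S.Z (k - 1 + 1) ∩ Z) = mulOp χk * T1' (k - 1))
    (hbot : h + 1 < k → S.T1 μ k h (S.Z (h + 1) ∩ Z) = T1' h * mulOp χh)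
    (hone : h + 1 = k → S.T1 μ k h (S.Z (h + 1) ∩ Z) = mulOp χk * T1' h * mulOp χh) (expA : MDens π) :
    Eq12 ((S.ops μ).T k Z) χk T1' χh ((S.ops μ).tail k h (S.Z h ∩ Z)) expA h k := by
  have hfac := ordProd_factor (fun j => S.T1 μ k j (S.Z (j + 1) ∩ Z)) T1' (mulOp χk) (mulOp χh) hhk hmid htop hbot hone
  unfold Eq12
  rw [S.prod222 μ hhk.le hZ Z hX, ← ordProd_eq, hfac]

end Eq12

/-! ## Part C. The (n+1)-st integral (1.25) p. 182 and the sentence after it -/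

section Form125

variable {δ : Type*} [DecidableEq δ] {π : δ → Type*} [∀ d, MeasurableSpace (π d)]
  (μ : ∀ d, Measure (π d)) [∀ d, SigmaFinite (μ d)]

/-- **(1.25)** p. 182 [PDF 8], verbatim: *"Now we will analyze the next, n + 1ˢᵗ integration. We integrate with respect to
the variables A_j, V_j localized in Z_{j+1}∖Z″_{j+1}. It is a part of the operation 𝕋^{(j)}(Z_{j+1}), and we have to consider
the following integral ∫dA_j⌈_{Z_{j+1}∩Ω_{j+1}} χ(Z_{j+1}∩Ω_{j+1}) exp[−½⟨A_j, C*Δ^{(j)}_{Λ^c_{j+1}}CA_j⟩] · ∫dV_j⌈_{Ω^c_{j+1}∖Z″_{j+1}}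
δ(V̄_jV_{j+1}⁻¹) ζ(Ω^c_{j+1}) χ_k^{(n)} exp A_k^{(n)}, (1.25) where n = j − h, and the quadratic form in the exponential is
written explicitly in (2.21) [III]."* — the word `∫_{sA} (χA·gauss) · ∫_{sV} (dlt·ζ) · (χn · expAn)`: `sA` = the variables
`A_j⌈_{Z_{j+1}∩Ω_{j+1}}`, `χA` = `χ(Z_{j+1}∩Ω_{j+1})`, `gauss` = `exp[−½⟨A_j, C*Δ^{(j)}_{Λ^c_{j+1}}CA_j⟩]`, `sV` = the variables
`V_j⌈_{Ω^c_{j+1}∖Z″_{j+1}}`, `dlt` = `δ(V̄_jV_{j+1}⁻¹)` (READING (a)), `ζ` = `ζ(Ω^c_{j+1})`, `χn` = `χ_k^{(n)}`, `expAn` = `exp A_k^{(n)}`.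
[cite: Balaban1989LargeFieldI, (1.25) p.182] -/
noncomputable def form125 (sA sV : Finset δ) (χA gauss dlt ζ χn expAn : MDens π) : MDens π :=
  (intOp μ sA (wmul χA gauss).1 (wmul χA gauss).2 * intOp μ sV (wmul dlt ζ).1 (wmul dlt ζ).2 :
    Function.End (MDens π)) (wmul χn expAn)

/-- (1.25) unfolded to the iterated fibre integral (definitional). [cite: Balaban1989LargeFieldI, (1.25) p.182] -/
theorem form125_val (sA sV : Finset δ) (χA gauss dlt ζ χn expAn : MDens π) :
    (form125 μ sA sV χA gauss dlt ζ χn expAn).1 =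
      ∫⋯∫⁻_sA, χA.1 * gauss.1 * ∫⋯∫⁻_sV, dlt.1 * ζ.1 * (χn.1 * expAn.1) ∂μ ∂μ := rfl

/-- (1.25), the sentences after it, p. 182, verbatim: *"In this integral we introduce the decomposition of unity 1 = χ_k^{(n+1)} +
(1 − χ_k^{(n+1)}) for each component of Z, and we exclude from Z the components with the large field functions 1 − χ_k^{(n+1)}.
The function χ_k^{(n+1)} does not depend on integration variables, and we have to consider the integral (1.25) multiplied by
χ_k^{(n+1)}."* — PROVED in the operator model: for `χ` independent of both variable sets, `χ · (1.25) = (1.25)` with `χ_k^{(n)}`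
replaced by `χ χ_k^{(n)}` (two pull-outs, `intOp_mulOp_of_indepOf`). [cite: Balaban1989LargeFieldI, p.182 (after (1.25))] -/
theorem mulOp_form125 (sA sV : Finset δ) (χA gauss dlt ζ χn expAn χ : MDens π) (hA : IndepOf sA χ.1)
    (hV : IndepOf sV χ.1) :
    (mulOp χ) (form125 μ sA sV χA gauss dlt ζ χn expAn) = form125 μ sA sV χA gauss dlt ζ (wmul χ χn) expAn := by
  have h1 := intOp_mulOp_of_indepOf μ sA (wmul χA gauss) χ hA
  have h2 := intOp_mulOp_of_indepOf μ sV (wmul dlt ζ) χ hV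
  have hF : (mulOp χ) (wmul χn expAn) = wmul (wmul χ χn) expAn := by
    apply Subtype.ext
    show χ.1 * (χn.1 * expAn.1) = χ.1 * χn.1 * expAn.1
    rw [mul_assoc]
  unfold form125
  rw [← hF]
  show (mulOp χ * (intOp μ sA (wmul χA gauss).1 (wmul χA gauss).2 * intOp μ sV (wmul dlt ζ).1 (wmul dlt ζ).2) :
      Function.End (MDens π)) (wmul χn expAn) = ((intOp μ sA (wmul χA gauss).1 (wmul χA gauss).2 *
      intOp μ sV (wmul dlt ζ).1 (wmul dlt ζ).2) * mulOp χ : Function.End (MDens π)) (wmul χn expAn)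
  rw [← mul_assoc, ← h1, mul_assoc, ← h2, ← mul_assoc]

end Form125

/-! ## Part D. The fluctuation integral (1.60) pp. 188–189 -/

section Form160

variable (δ : Type*) [DecidableEq δ] (π : δ → Type*) [∀ d, MeasurableSpace (π d)] (Cfg : Type*) [MeasurableSpace Cfg]

/-- THE DATA OF (1.60) pp. 188–189 [PDF 14–15], verbatim: *"The integral corresponding to (1.25) has the form of the fluctuation
field integral in (3.25) [III], more precisely it has the form χ_k^{(n+1)} exp[A_k^{(n)}(U_k^{(n+1)}, A_j = 0) + E₀^{(j)}(Ω^c_{j+1}∖Z″_{j+1})]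
· ∫dA_j⌈_{Z_{j+1}∩Ω_{j+1}} χ^{(j)}(Z_{j+1}∩Ω_{j+1}) exp[−½⟨A_j, C*Δ^{(j)}_{Λ^c_{j+1}}CA_j⟩] · z^{(j)} ∫dB_j⌈_{Ω^c_{j+1}∖Z″_{j+1}} χ′^{(j)}
exp[−½⟨B_j, C*Δ^{(j)}CB_j⟩ + ℙ^{(j)}(g_j, A_j, B_j) + {(𝔼_k + ℝ_k + 𝔹_k + 𝔹_k^{(n)})(U_k^{(n)}(exp i[g_jCB_j − hD̃(g_jCB_j)]V^{(j)}))
− (𝔼_k + ℝ_k + 𝔹_k + 𝔹_k^{(n)})(U_k^{(n+1)}, A_j = 0) + A(1/(g_k^{(n)}(·))² − 1/g_j², U_k^{(n)}(exp i[g_jCB_j − hD̃(g_jCB_j)]V^{(j)}))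
− A(1/(g_k^{(n)}(·))² − 1/g_j², U_k^{(n+1)})}]. (1.60) The notation used here is the same as in Sect. 3 [III], in particular
the constant E₀^{(j)}(Ω^c_{j+1}∖Z″_{j+1}) is equal to the constant in the first exponential in (3.15) [III], only for k replaced
by j"* — every printed constituent as a field (READING (b), (c)); the configurations `U_k^{(n)}(exp i[…]V^{(j)})` and
`U_k^{(n+1)}` (at `A_j = 0`) as measurable `Cfg`-valued functions of the variables, the functional `𝔼_k + ℝ_k + 𝔹_k + 𝔹_k^{(n)}`
and the Wilson-action difference `A(1/(g_k^{(n)}(·))² − 1/g_j², ·)` as measurable real functions on `Cfg`.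
[cite: Balaban1989LargeFieldI, (1.60) p.188] -/
structure Data160 where
  /-- the variables `A_j⌈_{Z_{j+1}∩Ω_{j+1}}` -/
  sA : Finset δ
  /-- the variables `B_j⌈_{Ω^c_{j+1}∖Z″_{j+1}}` -/
  sB : Finset δ
  /-- `χ_k^{(n+1)}` -/
  χn1 : MDens π
  /-- `A_k^{(n)}(U_k^{(n+1)}, A_j = 0)` -/
  An0 : MReal π
  /-- the constant `E₀^{(j)}(Ω^c_{j+1}∖Z″_{j+1})` -/
  E0 : ℝ
  /-- `χ^{(j)}(Z_{j+1}∩Ω_{j+1})` -/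
  χj : MDens π
  /-- the quadratic form `⟨A_j, C*Δ^{(j)}_{Λ^c_{j+1}}CA_j⟩` -/
  quadA : MReal π
  /-- the constant `z^{(j)}` -/
  z : ℝ≥0∞
  /-- `χ′^{(j)}` ((1.55)) -/
  χ' : MDens π
  /-- the quadratic form `⟨B_j, C*Δ^{(j)}CB_j⟩` -/
  quadB : MReal π
  /-- `ℙ^{(j)}(g_j, A_j, B_j)` -/
  P : MReal π
  /-- the functional `𝔼_k + ℝ_k + 𝔹_k + 𝔹_k^{(n)}` on configurations -/
  F : Cfg → ℝ
  hF : Measurable F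
  /-- the Wilson-action difference `A(1/(g_k^{(n)}(·))² − 1/g_j², ·)` -/
  Ac : Cfg → ℝ
  hAc : Measurable Ac
  /-- the configuration `U_k^{(n)}(exp i[g_jCB_j − hD̃(g_jCB_j)]V^{(j)})` as a function of the variables -/
  Ufl : (∀ d, π d) → Cfg
  hUfl : Measurable Ufl
  /-- the configuration `U_k^{(n+1)}` (at `A_j = 0`) as a function of the variables -/
  U1 : (∀ d, π d) → Cfg
  hU1 : Measurable U1

namespace Data160

variable {δ π Cfg} (D : Data160 δ π Cfg) (μ : ∀ d, Measure (π d)) [∀ d, SigmaFinite (μ d)]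

/-- The exponent of the `B_j`-integral of (1.60): `−½⟨B_j, C*Δ^{(j)}CB_j⟩ + ℙ^{(j)}(g_j, A_j, B_j) + {F(U_k^{(n)}(…)) − F(U_k^{(n+1)}) +
A(c, U_k^{(n)}(…)) − A(c, U_k^{(n+1)})}`, `F = 𝔼_k + ℝ_k + 𝔹_k + 𝔹_k^{(n)}`, `c = 1/(g_k^{(n)}(·))² − 1/g_j²`. [cite: Balaban1989LargeFieldI, (1.60) p.189] -/
def expo : MReal π :=
  ⟨fun V => -(1 / 2 : ℝ) * D.quadB.1 V + D.P.1 V + ((D.F (D.Ufl V) - D.F (D.U1 V)) + (D.Ac (D.Ufl V) - D.Ac (D.U1 V))),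
    ((measurable_const.mul D.quadB.2).add D.P.2).add
      (((D.hF.comp D.hUfl).sub (D.hF.comp D.hU1)).add ((D.hAc.comp D.hUfl).sub (D.hAc.comp D.hU1)))⟩

/-- The prefactor exponent `A_k^{(n)}(U_k^{(n+1)}, A_j = 0) + E₀^{(j)}(Ω^c_{j+1}∖Z″_{j+1})` of (1.60). [cite: Balaban1989LargeFieldI, (1.60) p.188] -/
def pre : MReal π := ⟨fun V => D.An0.1 V + D.E0, D.An0.2.add measurable_const⟩

/-- The Gaussian weight exponent `−½⟨A_j, C*Δ^{(j)}_{Λ^c_{j+1}}CA_j⟩` of the `A_j`-integral of (1.60). [cite: Balaban1989LargeFieldI, (1.60) p.188] -/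
def gaussA : MReal π := ⟨fun V => -(1 / 2 : ℝ) * D.quadA.1 V, measurable_const.mul D.quadA.2⟩

/-- **(1.60)** as ONE word applied to the density `1`:
`χ_k^{(n+1)} e^{pre} · ∫_{sA} (χ^{(j)} e^{gaussA}) · z^{(j)} · ∫_{sB} (χ′^{(j)} e^{expo}) · 1`. [cite: Balaban1989LargeFieldI, (1.60) p.188] -/
noncomputable def form : MDens π :=
  (mulOp (wmul D.χn1 (expD D.pre)) * intOp μ D.sA (wmul D.χj (expD D.gaussA)).1 (wmul D.χj (expD D.gaussA)).2 *
    mulOp (wconst D.z) * intOp μ D.sB (wmul D.χ' (expD D.expo)).1 (wmul D.χ' (expD D.expo)).2 :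
    Function.End (MDens π)) wone

/-- (1.60) unfolded to the iterated fibre integral (definitional). [cite: Balaban1989LargeFieldI, (1.60) p.188] -/
theorem form_val : (D.form μ).1 = D.χn1.1 * (expD D.pre).1 *
    ∫⋯∫⁻_D.sA, D.χj.1 * (expD D.gaussA).1 * ((fun _ => D.z) *
      ∫⋯∫⁻_D.sB, D.χ'.1 * (expD D.expo).1 * (fun _ => (1 : ℝ≥0∞)) ∂μ) ∂μ := rfl

end Data160

end Form160

/-! ## Part E. After the N integrations: (1.71), (1.72) p. 192 and (1.76) p. 194 -/

section AfterN

variable {ι δ : Type*} [DecidableEq δ] {π : δ → Type*} [∀ d, MeasurableSpace (π d)]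
  (μ : ∀ d, Measure (π d)) [∀ d, SigmaFinite (μ d)]

/-- **(1.72)** p. 192 [PDF 18], verbatim: *"the operations 𝕋″^{(j)} are defined by 𝕋″^{(j)}(Z″_{j+1}) = ∫dV_j⌈_{Z″_{j+1}} δ(V̄_jV_{j+1}⁻¹).
(1.72)"* — the fibre integral over the variables `vV j (Z″_{j+1})` = *"V_j⌈_{Z″_{j+1}}"* against the constraint weight `dlt j` =
`δ(V̄_jV_{j+1}⁻¹)` (READING (a), (b)). [cite: Balaban1989LargeFieldI, (1.72) p.192] -/
noncomputable def Tpp (vV : ℕ → Set ι → Finset δ) (Zpp : ℕ → Set ι) (dlt : ℕ → MDens π) (j : ℕ) :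
    Function.End (MDens π) :=
  intOp μ (vV j (Zpp (j + 1))) (dlt j).1 (dlt j).2

/-- (1.72) unfolded (definitional). [cite: Balaban1989LargeFieldI, (1.72) p.192] -/
theorem Tpp_apply_val (vV : ℕ → Set ι → Finset δ) (Zpp : ℕ → Set ι) (dlt : ℕ → MDens π) (j : ℕ) (F : MDens π) :
    ((Tpp μ vV Zpp dlt j) F).1 = ∫⋯∫⁻_(vV j (Zpp (j + 1))), (dlt j).1 * F.1 ∂μ := rfl

/-- (1.72), the sentence after it, p. 192, verbatim: *"The new action depends on the background field U″_k = U_k^{(N)}, and it has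
the form A″_k = A_k + 𝔹″_k, where 𝔹″_k is the sum of the new boundary terms described above."* [cite: Balaban1989LargeFieldI, (1.72) p.192] -/
def actionPP (Ak Bppk : MReal π) : MReal π := radd Ak Bppk

omit [DecidableEq δ] in
/-- `exp A″_k = exp A_k · exp 𝔹″_k` (from `A″_k = A_k + 𝔹″_k`). PROVED. [cite: Balaban1989LargeFieldI, (1.72) p.192] -/
theorem expD_actionPP (Ak Bppk : MReal π) : expD (actionPP Ak Bppk) = wmul (expD Ak) (expD Bppk) :=
  expD_radd Ak Bppk

/-- **(1.71)** p. 192 [PDF 18], verbatim: *"Let us write now the expressions we obtain after the N integrations, omiting the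
𝕋-operations for the large field regions not satisfying the conditions (i), (ii). These expressions have [t]he form
χ_k(Ω_k^{∼4}) Π_{j=k−1}^{h} 𝕋″^{(j)}(Z″_{j+1}) χ_h(Ω_h∩Z_h) 𝕋_h(Z_h) χ″_k exp A″_k, (1.71) where the superscript (N) in symbols of
the characteristic function and the action has been replaced by the double prime"* — the word `χk · Π_{j=k−1}^{h} 𝕋″^{(j)}(Z″_{j+1})
· χhZ · 𝕋_h(Z_h)` applied to `χ″_k exp A″_k`: `χk` = `χ_k(Ω_k^{∼4})`, the `𝕋″^{(j)}` of (1.72) (`Tpp`), `χhZ` = `χ_h(Ω_h∩Z_h)`, `Th` =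
`𝕋_h(Z_h)` (READING (d)), `χpp` = `χ″_k`, `App` = `A″_k`. [cite: Balaban1989LargeFieldI, (1.71) p.192] -/
noncomputable def form171 (χk : MDens π) (vV : ℕ → Set ι → Finset δ) (Zpp : ℕ → Set ι) (dlt : ℕ → MDens π)
    (h k : ℕ) (χhZ : MDens π) (Th : Function.End (MDens π)) (χpp : MDens π) (App : MReal π) : MDens π :=
  (mulOp χk * ordProd (Tpp μ vV Zpp dlt) h k * mulOp χhZ * Th : Function.End (MDens π)) (wmul χpp (expD App))

/-- The variables *"dV″⌈_{𝔹″_k ∩ Y}"* of (1.76), p. 194, verbatim: *"The variables V″ are determined by, and defined on the set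
𝔹″_k, i.e., V″ = V_j on Γ″_j, j = 0, 1, …, k − 1, k."* — the union over `j ≤ k` of the variables `V_j⌈_{Γ″_j ∩ Y}` (`Γ j` = the
region `Γ″_j` of the generating set (1.13), as a region of the ambient point type). [cite: Balaban1989LargeFieldI, (1.76) p.194] -/
def varsGen (vV : ℕ → Set ι → Finset δ) (Γ : ℕ → Set ι) (k : ℕ) (Y : Set ι) : Finset δ :=
  (Finset.range (k + 1)).biUnion fun j => vV j (Γ j ∩ Y)

/-- Membership in `varsGen`: a variable of `V″⌈_Y` is a variable of some `V_j⌈_{Γ″_j ∩ Y}`, `j ≤ k` (*"V″ = V_j on Γ″_j,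
j = 0, 1, …, k − 1, k"*). [cite: Balaban1989LargeFieldI, (1.76) p.194] -/
theorem mem_varsGen (vV : ℕ → Set ι → Finset δ) (Γ : ℕ → Set ι) (k : ℕ) (Y : Set ι) (d : δ) :
    d ∈ varsGen vV Γ k Y ↔ ∃ j, j ≤ k ∧ d ∈ vV j (Γ j ∩ Y) := by
  simp [varsGen]

/-- **(1.76)** p. 194 [PDF 20], verbatim: *"Omitting the 𝕋_k-operation for the remaining components, as in (1.71), and using the
form (1.72) of the operations 𝕋″^{(j)}, we obtain the expressions χ_k(Ω_k^{∼4}) χ_{k,Λ} ∫dV_h⌈_{Z_h} χ_h(Ω_h∩Z_h) 𝕋_h(Z_h)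
∫dV″⌈_{𝔹″_k∩(Λ∩Z^c_h)} χ″_k exp A″_k. (1.76) The variables V″ are determined by, and defined on the set 𝔹″_k, i.e., V″ = V_j on
Γ″_j, j = 0, 1, …, k − 1, k. The two integrals above are over the disjoint regions of integrations, hence we can consider them
independently."* — the word `(χk·χkΛ) · ∫_{V_h⌈Z_h} χhZ · 𝕋_h(Z_h) · ∫_{V″⌈𝔹″_k∩(Λ∩Z_h^c)} 1` applied to `χ″_k exp A″_k`:
`χkΛ` = `χ_{k,Λ}` ((1.75), `…B15.PrelimIntegrations.Chi175`), `Z` = the large-field regions, `Γpp` = the regions `Γ″_j` of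
`𝔹″_k` ((1.13)), the rest as in (1.71).  The passage (1.71) + (1.75) ⟹ (1.76) (*"they are all integrated out"*) is NOT
typed (module docstring). [cite: Balaban1989LargeFieldI, (1.76) p.194] -/
noncomputable def form176 (χk χkΛ : MDens π) (vV : ℕ → Set ι → Finset δ) (Z : ℕ → Set ι) (h : ℕ) (χhZ : MDens π)
    (Th : Function.End (MDens π)) (Γpp : ℕ → Set ι) (k : ℕ) (Λ : Set ι) (χpp : MDens π) (App : MReal π) :
    MDens π :=
  (mulOp (wmul χk χkΛ) * intOp μ (vV h (Z h)) χhZ.1 χhZ.2 * Th *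
    intOp μ (varsGen vV Γpp k (Λ ∩ (Z h)ᶜ)) wone.1 wone.2 : Function.End (MDens π)) (wmul χpp (expD App))

/-- (1.76) unfolded to the iterated fibre integral (definitional). [cite: Balaban1989LargeFieldI, (1.76) p.194] -/
theorem form176_val (χk χkΛ : MDens π) (vV : ℕ → Set ι → Finset δ) (Z : ℕ → Set ι) (h : ℕ) (χhZ : MDens π)
    (Th : Function.End (MDens π)) (Γpp : ℕ → Set ι) (k : ℕ) (Λ : Set ι) (χpp : MDens π) (App : MReal π) :
    (form176 μ χk χkΛ vV Z h χhZ Th Γpp k Λ χpp App).1 = χk.1 * χkΛ.1 *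
      ∫⋯∫⁻_(vV h (Z h)), χhZ.1 * (Th ((intOp μ (varsGen vV Γpp k (Λ ∩ (Z h)ᶜ)) wone.1 wone.2)
        (wmul χpp (expD App)))).1 ∂μ := rfl

end AfterN

/-! ## Part F. (v1.1, `lit-balaban-r12` gen 5) The one-step boundary term `ℂ_k^{(n+1)}` of (1.62) p. 189 over the fluctuation
integral (1.60): the first member of (1.62) (row B15.Eq1.62; the second member `𝔹_k^{(n+1)} = 𝔹_k^{(n)} + ℂ_k^{(n+1)}` is the
running sum `B15.PrelimIntegrations.bdryTerms_succ`, not restated) -/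

section C162

variable {δ : Type*} [DecidableEq δ] {π : δ → Type*} [∀ d, MeasurableSpace (π d)] {Cfg : Type*} [MeasurableSpace Cfg]

namespace Data160

variable (D : Data160 δ π Cfg) (μ : ∀ d, Measure (π d)) [∀ d, SigmaFinite (μ d)]

/-- *"the ∫ in (1.60)"* of (1.62) p. 189 [PDF 15]: the integral factor of (1.60) WITHOUT its prefactor
`χ_k^{(n+1)} exp[A_k^{(n)}(U_k^{(n+1)}, A_j = 0) + E₀^{(j)}(Ω^c_{j+1}∖Z″_{j+1})]` — the word
`∫_{sA}(χ^{(j)} e^{gaussA}) · z^{(j)} · ∫_{sB}(χ′^{(j)} e^{expo})` applied to the density `1`. [cite: Balaban1989LargeFieldI, (1.62) p.189] -/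
noncomputable def integral : MDens π :=
  (intOp μ D.sA (wmul D.χj (expD D.gaussA)).1 (wmul D.χj (expD D.gaussA)).2 * mulOp (wconst D.z) *
    intOp μ D.sB (wmul D.χ' (expD D.expo)).1 (wmul D.χ' (expD D.expo)).2 : Function.End (MDens π)) wone

/-- (1.60) is its prefactor times *"the ∫ in (1.60)"* (definitional: the operation monoid is composition).
[cite: Balaban1989LargeFieldI, (1.60) p.188] -/
theorem form_eq_mulOp_integral : D.form μ = mulOp (wmul D.χn1 (expD D.pre)) (D.integral μ) := rfl

/-- The value of *"the ∫ in (1.60)"*: the iterated fibre integral (definitional). [cite: Balaban1989LargeFieldI, (1.62) p.189] -/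
theorem integral_val : (D.integral μ).1 =
    ∫⋯∫⁻_D.sA, D.χj.1 * (expD D.gaussA).1 * ((fun _ => D.z) *
      ∫⋯∫⁻_D.sB, D.χ'.1 * (expD D.expo).1 * (fun _ => (1 : ℝ≥0∞)) ∂μ) ∂μ := rfl

/-- **(1.62), first member** p. 189 [PDF 15], verbatim: *"Now it is clear that the integral in (1.60) determines a main
contribution to ℂ_k^{(n+1)}, another comes from the renormalization of the Wilson action, thus ℂ_k^{(n+1)} = log(the ∫ in
(1.60)) + A(1/(g_k^{(n+1)}(·))² − 1/(g_k^{(n)}(·))², U_k^{(n+1)})"* — as a measurable real function of all the variables: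
`Ac'` ↤ the Wilson-action difference functional `A(1/(g_k^{(n+1)}(·))² − 1/(g_k^{(n)}(·))², ·)` on configurations (a datum,
like `D.Ac` = the difference with the OLD coefficient inside (1.60)), composed with `U_k^{(n+1)}` = `D.U1`; the logarithm is
taken of the real value of the integral (p. 176: *"the densities are positive"*; `Real.log`/`toReal` give junk at `0`/`∞`,
which the positivity proviso excludes). [cite: Balaban1989LargeFieldI, (1.62) p.189] -/
noncomputable def C162 (Ac' : Cfg → ℝ) (hAc' : Measurable Ac') : MReal π :=
  ⟨fun V => Real.log ((D.integral μ).1 V).toReal + Ac' (D.U1 V),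
    (D.integral μ).2.ennreal_toReal.log.add (hAc'.comp D.hU1)⟩

/-- The value of `ℂ_k^{(n+1)}`, unfolded (definitional). [cite: Balaban1989LargeFieldI, (1.62) p.189] -/
theorem C162_val (Ac' : Cfg → ℝ) (hAc' : Measurable Ac') (V : ∀ d, π d) :
    (D.C162 μ Ac' hAc').1 V = Real.log ((D.integral μ).1 V).toReal + Ac' (D.U1 V) := rfl

/-- Why (1.62) is the right bookkeeping: where *"the ∫ in (1.60)"* is positive and finite, `exp ℂ_k^{(n+1)}` REPRODUCES it
times the Wilson-action factor, `e^{ℂ} = (the ∫ in (1.60)) · exp A(…, U_k^{(n+1)})` — so moving `ℂ_k^{(n+1)}` into the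
boundary terms `𝔹_k^{(n+1)} = 𝔹_k^{(n)} + ℂ_k^{(n+1)}` of the effective action accounts exactly for the integral.
[cite: Balaban1989LargeFieldI, (1.62) p.189] -/
theorem expD_C162 (Ac' : Cfg → ℝ) (hAc' : Measurable Ac') (V : ∀ d, π d) (h0 : (D.integral μ).1 V ≠ 0)
    (htop : (D.integral μ).1 V ≠ ∞) :
    (expD (D.C162 μ Ac' hAc')).1 V = (D.integral μ).1 V * ENNReal.ofReal (Real.exp (Ac' (D.U1 V))) := by
  have hpos : 0 < ((D.integral μ).1 V).toReal := ENNReal.toReal_pos h0 htop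
  rw [expD_val, C162_val, Real.exp_add, Real.exp_log hpos, ENNReal.ofReal_mul hpos.le, ENNReal.ofReal_toReal htop]

end Data160

end C162

end

end Literature.MathematicalPhysics.QuantumFieldTheory.Balaban1983to89.B15IntegrationForms
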